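import Literature.AlgebraicGeometry.RelativeSpec.FreeQuotientEtale
import Literature.AlgebraicGeometry.RelativeSpec.FiniteGroupQuotientGluing
import Literature.AlgebraicGeometry.Motives.CartierDivisor
import HarnessLib

/-!
# Quotients of integral schemes by finite groups: `X → X/G` is generically étale for a faithful
# action (SGA 1, Exp. V, §2)

Let the finite group `G` act on the INTEGRAL scheme `X` over an affine base `Y` (`ActionOver r G`,
`r : X → Y` separated), with every point in a `G`-stable open affine over `Y` (so that the glued
quotient `π : X → X/G` of `…RelativeSpec.FiniteGroupQuotientGluing` exists), and suppose the
action is FAITHFUL ON THE FUNCTION FIELD: `g♯ ≠ id` on `K(X)` for `g ≠ 1`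
(`Literature.AlgebraicGeometry.Motives.RatFn.functionFieldMap`). Then `π` is ÉTALE OVER A
NON-EMPTY OPEN of `X/G` (`ActionOver.exists_etale_morphismRestrict_gluedMk`). This is SGA 1,
Exp. V, Cor. 2.4 / Prop. 2.6 at the generic point: the inertia group of the generic point `ξ` is
the kernel of `G → Aut K(X)`, trivial by faithfulness, so `π` is étale at `ξ`, hence over an open.

Proof given here (free locus made explicit): for `g ≠ 1` pick `a_g ∈ K(X)` moved by `(g⁻¹)♯` and
write `a_g` and `((g⁻¹)♯ a_g - a_g)⁻¹` as germs of sections over a common affine open `W ∋ ξ`;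
on the `G`-stable affine `O = ⋂_h h⁻¹W` (`exists_stableAffineOpen_le`) the elements
`g • b_g - b_g` (`b_g = a_g|_O`) are then UNITS, so the action on `O` is free in the sense of
Chase–Harrison–Rosenberg and `O → O/G` is étale (`…RelativeSpec.FreeQuotientEtale`); finally
`O/G ↪ X/G` is a chart over which `π` is `O → O/G` (`ActionOver.isPullback_chart`).

Also: `eq_id_of_functionFieldMap_eq_id` — an endomorphism over a separated base of an integral
scheme which induces the identity on the function field is the identity (so a faithful
`G → Aut X` is faithful on `K(X)`: `functionFieldMap_ne_id_of_injective`).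

Everything is proved; no named facts.

## References

* A. Grothendieck, *SGA 1*, Exp. V, §2: Cor. 2.4, Prop. 2.6. [SGA1]
* D. Mumford, *Abelian Varieties* (1970), §7, Thm. p. 66. [MumfordAV1970]
-/

noncomputable section

universe u

open CategoryTheory Limits AlgebraicGeometry
open Literature.AlgebraicGeometry.Motives Literature.AlgebraicGeometry.Motives.RatFn

namespace Literature.AlgebraicGeometry.RelativeSpec

/-! ### Function fields: germs of pulled-back sections; endomorphisms trivial on `K(X)` -/

section FunctionField

variable {X Y : Scheme.{u}} [IsIntegral X] [IsIntegral Y]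

/-- The generic point of `X` lies in the preimage of an open containing the generic point of `Y`
under a dominant morphism. [folklore] -/
theorem genericPoint_mem_preimage_of_isDominant (f : X ⟶ Y) [IsDominant f] {U : Y.Opens}
    (hU : genericPoint Y ∈ U) : genericPoint X ∈ f ⁻¹ᵁ U := by
  change f (genericPoint X) ∈ U
  rw [genericPoint_eq_of_isDominant f]
  exact hU

/-- **Germs of pulled-back sections**: for a dominant `f : X → Y`, `V ≤ f⁻¹U` and `s ∈ Γ(Y, U)`,
the germ at the generic point of `f^*(s)|_V` is `f♯` of the germ of `s` (Görtz–Wedhorn I,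
(11.16)). [folklore] -/
theorem germ_appLE_eq_functionFieldMap (f : X ⟶ Y) [IsDominant f] {U : Y.Opens} {V : X.Opens}
    (e : V ≤ f ⁻¹ᵁ U) (hU : genericPoint Y ∈ U) (hV : genericPoint X ∈ V) (s : Γ(Y, U)) :
    X.presheaf.germ V (genericPoint X) hV (f.appLE U V e s) =
      functionFieldMap f (Y.presheaf.germ U (genericPoint Y) hU s) := by
  have h1 : f (genericPoint X) ∈ U := genericPoint_mem_preimage_of_isDominant f hU
  have e1 : Y.presheaf.germ U (genericPoint Y) hU s =
      toFunctionField (f (genericPoint X)) (Y.presheaf.germ U _ h1 s) := by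
    simp only [toFunctionField, RingHom.algebraMap_toAlgebra]
    exact (TopCat.Presheaf.germ_stalkSpecializes_apply Y.presheaf _ _ s).symm
  rw [e1, functionFieldMap_toFunctionField, Scheme.Hom.germ_stalkMap_apply]
  simp only [toFunctionField, RingHom.algebraMap_toAlgebra, Scheme.Hom.appLE,
    CommRingCat.comp_apply]
  rw [TopCat.Presheaf.germ_res_apply X.presheaf]
  exact (TopCat.Presheaf.germ_stalkSpecializes_apply X.presheaf _ _ _).symm

/-- **An endomorphism of an integral scheme over a separated base which is the identity on the
function field is the identity**: it agrees with `𝟙` after `Spec K(X) → X`, which is dominant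
(Mathlib `ext_of_isDominant_of_isSeparated`). [folklore] -/
theorem eq_id_of_functionFieldMap_eq_id {Z : Scheme.{u}} (f : X ⟶ X) [IsDominant f] (s : X ⟶ Z)
    [IsSeparated s] (hs : f ≫ s = s) (hf : functionFieldMap f = RingHom.id _) : f = 𝟙 X := by
  -- `Spec K(X) → X` is dominant: its range contains the generic point
  haveI : IsDominant (X.fromSpecStalk (genericPoint X)) := by
    refine ⟨Dense.mono ?_ (dense_iff_closure_eq.mpr (genericPoint_spec X))⟩
    rintro _ ⟨⟩
    exact ⟨IsLocalRing.closedPoint _, Scheme.fromSpecStalk_closedPoint⟩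
  refine ext_of_isDominant_of_isSeparated s (by rw [hs, Category.id_comp])
    (X.fromSpecStalk (genericPoint X)) ?_
  have key : Spec.map (X.presheaf.stalkSpecializes (specializes_genericPoint f) ≫
      f.stalkMap (genericPoint X)) ≫ X.fromSpecStalk (genericPoint X) =
        X.fromSpecStalk (genericPoint X) ≫ f := by
    rw [Spec.map_comp, Category.assoc, Scheme.SpecMap_stalkSpecializes_fromSpecStalk,
      Scheme.SpecMap_stalkMap_fromSpecStalk]
  have hid : X.presheaf.stalkSpecializes (specializes_genericPoint f) ≫
      f.stalkMap (genericPoint X) = 𝟙 _ := by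
    ext1
    exact hf
  rw [← key, hid, Spec.map_id, Category.id_comp, Category.comp_id]

/-- Every rational function is the germ at the generic point of a section over some open
containing the generic point. [folklore] -/
theorem exists_germ_genericPoint_eq (a : X.functionField) :
    ∃ (U : X.Opens) (hU : genericPoint X ∈ U) (s : Γ(X, U)),
      X.presheaf.germ U (genericPoint X) hU s = a :=
  TopCat.Presheaf.exists_germ_eq X.presheaf a

end FunctionField

namespace ActionOver

set_option backward.isDefEq.respectTransparency false

/-! ### Faithful actions are faithful on the function field -/

section Faithful

variable {X Y : Scheme.{u}} {r : X ⟶ Y} {G : Type*} [Group G] (ρ : ActionOver r G)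
  [IsIntegral X] [IsSeparated r]

/-- **A faithful action on an integral scheme over a separated base is faithful on the function
field**: if `ρ : G → Aut X` is injective then `g♯ ≠ id` on `K(X)` for `g ≠ 1`. [folklore] -/
theorem functionFieldMap_ne_id_of_injective (hρ : Function.Injective ρ.aut) (g : G) (hg : g ≠ 1) :
    functionFieldMap (ρ.aut g).hom ≠ RingHom.id _ := by
  intro h
  have h1 : (ρ.aut g).hom = 𝟙 X := eq_id_of_functionFieldMap_eq_id _ r (ρ.aut_comp g) h
  apply hg
  apply hρ
  rw [map_one]
  ext1
  exact h1

end Faithful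

/-! ### Stable affine opens inside a given affine open -/

section Stable

variable {X Y : Scheme.{u}} {r : X ⟶ Y} {G : Type*} [Group G] [Finite G] (ρ : ActionOver r G)

omit [Finite G] in
/-- `(ρ g) ≫ (ρ h) = ρ (h g)`. [folklore] -/
theorem aut_hom_comp_aut_hom' (g h : G) : (ρ.aut g).hom ≫ (ρ.aut h).hom = (ρ.aut (h * g)).hom := by
  rw [map_mul, Aut.Aut_mul_def]; rfl

/-- **Orbits in an affine open give stable affine neighbourhoods inside it** (Mumford, AV §7,
Thm. p. 66, the reduction "`X` is covered by `G`-stable affine opens"): if `X` is separated,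
`Y` affine and the orbit of `x` lies in the affine open `U`, then `⋂_g g⁻¹U` is a `G`-stable
affine open neighbourhood of `x` CONTAINED IN `U`. [cite: MumfordAV1970, §7 Thm. p. 66 (proof)] -/
theorem exists_stableAffineOpen_le_of_orbit [X.IsSeparated] [IsAffine Y] (x : X) (U : X.Opens)
    (hU : IsAffineOpen U) (hx : ∀ g : G, (ρ.aut g).hom x ∈ U) :
    ∃ O : ρ.StableAffineOpens, x ∈ O.1 ∧ O.1 ≤ U := by
  classical
  haveI : Fintype G := Fintype.ofFinite G
  let V : G → X.Opens := fun g ↦ (ρ.aut g).hom ⁻¹ᵁ U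
  let O : X.Opens := Finset.univ.inf V
  have hmem : ∀ y : X, y ∈ O ↔ ∀ g : G, (ρ.aut g).hom y ∈ U := fun y ↦ by
    rw [← SetLike.mem_coe, TopologicalSpace.Opens.coe_finset_inf, Finset.inf_eq_iInf]
    simp only [Function.comp_apply, Set.iInf_eq_iInter, Set.mem_iInter, SetLike.mem_coe,
      Finset.mem_univ, forall_const]
    rfl
  have hO : ∀ g : G, (ρ.aut g).hom ⁻¹ᵁ O = O := by
    intro g
    ext y
    change (ρ.aut g).hom y ∈ O ↔ y ∈ O
    rw [hmem, hmem]
    constructor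
    · intro H h
      have := H (h * g⁻¹)
      rwa [← Scheme.Hom.comp_apply, ρ.aut_hom_comp_aut_hom', inv_mul_cancel_right] at this
    · intro H h
      rw [← Scheme.Hom.comp_apply, ρ.aut_hom_comp_aut_hom']
      exact H (h * g)
  have hOaff : IsAffineOpen O := by
    have : ∀ (s : Finset G), s.Nonempty → IsAffineOpen (s.inf V) := by
      intro s hs
      induction hs using Finset.Nonempty.cons_induction with
      | singleton a => simpa using hU.preimage_of_isIso (ρ.aut a).hom
      | cons a s ha hs ih => rw [Finset.cons_eq_insert, Finset.inf_insert]
                             exact (hU.preimage_of_isIso (ρ.aut a).hom).inf ih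
    exact this _ ⟨1, Finset.mem_univ _⟩
  haveI : IsAffine (O : Scheme.{u}) := hOaff
  refine ⟨⟨O, hO, inferInstance⟩, (hmem x).mpr hx, ?_⟩
  intro y hy
  have := (hmem y).mp hy 1
  rwa [map_one] at this

end Stable

/-! ### Units `g • b - b` make `O → O/G` étale; charts -/

section Piece

variable {X Y : Scheme.{u}} {r : X ⟶ Y} {G : Type*} [Group G] [Finite G] (ρ : ActionOver r G)
  [Y.IsSeparated] [IsSeparated r]

omit [Y.IsSeparated] in
/-- **If for every `g ≠ 1` some `g • b - b` is a unit on the `G`-stable affine `O`, then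
`O → O/G` is étale** (the action on `O` is free in the sense of Chase–Harrison–Rosenberg over
every affine of the affine base, the units restricting to units; `etale_toQuotient`).
[cite: SGA1, Exp. V, Prop. 2.6] -/
theorem etale_pieceMk_of_isUnit [IsAffine Y] (O : ρ.StableAffineOpens)
    (h : ∀ g : G, g ≠ 1 → ∃ b : Γ(↑O.1, (O.1.ι ≫ r) ⁻¹ᵁ ⊤),
      IsUnit ((ρ.restrict O.1 O.2.1).act g ⊤ b - b)) :
    Etale (ρ.pieceMk O) := by
  refine (ρ.restrict O.1 O.2.1).etale_toQuotient fun U g hg ↦ ?_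
  obtain ⟨b, hb⟩ := h g hg
  let res := (O.1 : Scheme.{u}).presheaf.map (homOfLE ((O.1.ι ≫ r).preimage_mono
    (le_top (a := U.1)))).op
  refine Ideal.eq_top_of_isUnit_mem _ (Ideal.subset_span ⟨res b, rfl⟩) ?_
  change IsUnit ((ρ.restrict O.1 O.2.1).act g U.1 (res b) - res b)
  rw [← (ρ.restrict O.1 O.2.1).map_act (le_top (a := U.1)) g b, ← map_sub]
  exact hb.map _

variable (hcov : ∀ x : X, ∃ O : ρ.StableAffineOpens, x ∈ O.1)

/-- **Charts**: over the open `O/G ⊆ X/G`, the quotient map `π : X → X/G` is `O → O/G`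
(`isPullback_chart`); hence any property respecting isomorphisms passes from `O → O/G` to the
restriction of `π` over `O/G`. [folklore] -/
theorem morphismRestrict_gluedMk_of_pieceMk (P : MorphismProperty Scheme.{u}) [P.RespectsIso]
    (O : ρ.StableAffineOpens) (h : P (ρ.pieceMk O)) :
    P (ρ.gluedMk hcov ∣_ (ρ.gluedι O).opensRange) := by
  have H1 := ρ.isPullback_chart hcov O
  have H2 := isPullback_morphismRestrict (ρ.gluedMk hcov) (ρ.gluedι O).opensRange
  -- `O/G ≅` the open `range (O/G ↪ X/G)`
  let e := IsOpenImmersion.isoOfRangeEq (ρ.gluedι O) (ρ.gluedι O).opensRange.ι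
    (by rw [Scheme.Opens.range_ι, Scheme.Hom.coe_opensRange])
  have he : e.hom ≫ (ρ.gluedι O).opensRange.ι = ρ.gluedι O := IsOpenImmersion.isoOfRangeEq_hom_fac _ _ _
  have H1' : IsPullback (ρ.pieceMk O ≫ e.hom) O.1.ι (ρ.gluedι O).opensRange.ι (ρ.gluedMk hcov) := by
    refine IsPullback.of_iso H1 (Iso.refl _) e (Iso.refl _) (Iso.refl _) ?_ ?_ ?_ ?_ <;>
      simp [he]
  let φ := H1'.isoIsPullback _ _ H2
  have hφ : φ.hom ≫ (ρ.gluedMk hcov ∣_ (ρ.gluedι O).opensRange) = ρ.pieceMk O ≫ e.hom :=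
    H1'.isoIsPullback_hom_fst _ _ H2
  rw [← P.cancel_left_of_respectsIso φ.hom, hφ, P.cancel_right_of_respectsIso]
  exact h

end Piece

/-! ### Generic étaleness of `X → X/G` for a faithful action -/

section Generic

variable {X Y : Scheme.{u}} {r : X ⟶ Y} {G : Type*} [Group G] [Finite G] (ρ : ActionOver r G)
  [IsIntegral X] [IsAffine Y] [IsSeparated r]
  (hcov : ∀ x : X, ∃ O : ρ.StableAffineOpens, x ∈ O.1)

omit [Finite G] [IsAffine Y] [IsSeparated r] in
/-- The generic point is fixed by every automorphism. [folklore] -/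
theorem aut_apply_genericPoint (g : G) : (ρ.aut g).hom (genericPoint X) = genericPoint X :=
  genericPoint_eq_of_isDominant _

omit [Finite G] [IsIntegral X] [IsAffine Y] [IsSeparated r] in
/-- **Equivariance of `Γ(X, O) → Γ(O, ⊤)`**: pulling back a section over the `G`-stable `O`
along `g⁻¹` and then passing to `O` is the action of `g` on `Γ(O, ⊤)` for the restricted action.
[folklore] -/
theorem act_restrict_top_appLE (O : ρ.StableAffineOpens) (g : G) (t : Γ(X, O.1))
    (hle : (⊤ : (O.1 : Scheme.{u}).Opens) ≤ O.1.ι ⁻¹ᵁ O.1)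
    (hst : O.1 ≤ (ρ.aut g⁻¹).hom ⁻¹ᵁ O.1) :
    (ρ.restrict O.1 O.2.1).act g ⊤ (O.1.ι.appLE O.1 ⊤ hle t) =
      O.1.ι.appLE O.1 ⊤ hle ((ρ.aut g⁻¹).hom.appLE O.1 O.1 hst t) := by
  have key : ∀ (φ ψ : (O.1 : Scheme.{u}) ⟶ X) (_ : φ = ψ)
      (h₁ : (⊤ : (O.1 : Scheme.{u}).Opens) ≤ φ ⁻¹ᵁ O.1)
      (h₂ : (⊤ : (O.1 : Scheme.{u}).Opens) ≤ ψ ⁻¹ᵁ O.1), φ.appLE O.1 ⊤ h₁ = ψ.appLE O.1 ⊤ h₂ := by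
    rintro φ _ rfl _ _; rfl
  have H : ∀ h₁, O.1.ι.appLE O.1 ⊤ hle ≫ (ρ.restrictHom O.1 O.2.1 g⁻¹).appLE _ _ h₁ =
      (ρ.aut g⁻¹).hom.appLE O.1 O.1 hst ≫ O.1.ι.appLE O.1 ⊤ hle := fun h₁ => by
    rw [Scheme.Hom.appLE_comp_appLE, Scheme.Hom.appLE_comp_appLE]
    exact key _ _ (ρ.restrictHom_ι O.1 O.2.1 g⁻¹) _ _
  rw [act_apply, restrict_aut_hom]
  exact DFunLike.congr_fun (congrArg CommRingCat.Hom.hom (H _)) t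

include hcov in
/-- **`X → X/G` is generically étale for an action faithful on the function field** (SGA 1,
Exp. V, Cor. 2.4 / Prop. 2.6 at the generic point, whose inertia group is the kernel of
`G → Aut K(X)`): for `X` integral, separated over the affine `Y`, covered by `G`-stable affine
opens, and `g♯ ≠ id` on `K(X)` for all `g ≠ 1`, there is a non-empty open `U ⊆ X/G` over which
`π : X → X/G` is étale. [cite: SGA1, Exp. V, Prop. 2.6] -/
theorem exists_etale_morphismRestrict_gluedMk
    (hfaith : ∀ g : G, g ≠ 1 → functionFieldMap (ρ.aut g).hom ≠ RingHom.id _) :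
    ∃ U : ρ.glued.Opens, (U : Set ρ.glued).Nonempty ∧ Etale (ρ.gluedMk hcov ∣_ U) := by
  classical
  haveI : Fintype G := Fintype.ofFinite G
  haveI : X.IsSeparated := by
    -- `X` is separated over the separated `Y` (cf. `Scheme.isSeparated_of_isSeparated_over`)
    constructor
    rw [← terminal.comp_from r]
    infer_instance
  set ξ := genericPoint X with hξ
  -- Step 1: for `g ≠ 1`, a rational function `a g` moved by `(g⁻¹)♯`, with `c g := (g⁻¹)♯ a - a ≠ 0`
  have hmove : ∀ g : G, ∃ a : X.functionField,
      g ≠ 1 → functionFieldMap (ρ.aut g⁻¹).hom a ≠ a := by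
    intro g
    by_cases hg : g = 1
    · exact ⟨0, fun h => (h hg).elim⟩
    · have hne := hfaith g⁻¹ (inv_ne_one.mpr hg)
      by_contra hall
      apply hne
      ext x
      by_contra hx
      exact hall ⟨x, fun _ => hx⟩
  choose a ha using hmove
  -- Step 2: sections over a common affine open `W ∋ ξ` for `a g` and `(c g)⁻¹`
  have hsec : ∀ g : G, ∃ (U : X.Opens) (hU : ξ ∈ U) (s t : Γ(X, U)),
      X.presheaf.germ U ξ hU s = a g ∧
      X.presheaf.germ U ξ hU t = (functionFieldMap (ρ.aut g⁻¹).hom (a g) - a g)⁻¹ := by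
    intro g
    obtain ⟨U₁, hU₁, s, hs⟩ := exists_germ_genericPoint_eq (a g)
    obtain ⟨U₂, hU₂, t, ht⟩ := exists_germ_genericPoint_eq
      (functionFieldMap (ρ.aut g⁻¹).hom (a g) - a g)⁻¹
    refine ⟨U₁ ⊓ U₂, ⟨hU₁, hU₂⟩, X.presheaf.map (homOfLE inf_le_left).op s,
      X.presheaf.map (homOfLE inf_le_right).op t, ?_, ?_⟩
    · rw [TopCat.Presheaf.germ_res_apply X.presheaf]; exact hs
    · rw [TopCat.Presheaf.germ_res_apply X.presheaf]; exact ht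
  choose U hU s t hs ht using hsec
  let V₀ : X.Opens := Finset.univ.inf U
  have hV₀ : ξ ∈ V₀ := by
    rw [← SetLike.mem_coe, TopologicalSpace.Opens.coe_finset_inf, Finset.inf_eq_iInf]
    simp only [Function.comp_apply, Set.iInf_eq_iInter, Set.mem_iInter, SetLike.mem_coe,
      Finset.mem_univ, forall_const]
    exact hU
  have hV₀U : ∀ g, V₀ ≤ U g := fun g => Finset.inf_le (Finset.mem_univ g)
  obtain ⟨W, hWaff, hξW, hWV₀⟩ := exists_isAffineOpen_mem_and_subset hV₀
  -- Step 3: a `G`-stable affine `O ∋ ξ` inside `W`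
  obtain ⟨O, hξO, hOW⟩ := ρ.exists_stableAffineOpen_le_of_orbit ξ W hWaff
    (fun g => by rw [ρ.aut_apply_genericPoint]; exact hξW)
  have hOU : ∀ g, O.1 ≤ U g := fun g => hOW.trans fun x hx => hV₀U g (hWV₀ hx)
  -- Step 4: the units `g • b_g - b_g` on `Γ(O, ⊤)`
  have hle : (⊤ : (O.1 : Scheme.{u}).Opens) ≤ O.1.ι ⁻¹ᵁ O.1 := by
    rw [Scheme.Opens.ι_preimage_self]
  let ψ : Γ(X, O.1) →+* Γ(↑O.1, (O.1.ι ≫ r) ⁻¹ᵁ ⊤) := (O.1.ι.appLE O.1 ⊤ hle).hom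
  have hunit : ∀ g : G, g ≠ 1 → ∃ b : Γ(↑O.1, (O.1.ι ≫ r) ⁻¹ᵁ ⊤),
      IsUnit ((ρ.restrict O.1 O.2.1).act g ⊤ b - b) := by
    intro g hg
    have hst : O.1 ≤ (ρ.aut g⁻¹).hom ⁻¹ᵁ O.1 := (O.2.1 g⁻¹).ge
    let s' : Γ(X, O.1) := X.presheaf.map (homOfLE (hOU g)).op (s g)
    let t' : Γ(X, O.1) := X.presheaf.map (homOfLE (hOU g)).op (t g)
    let w : Γ(X, O.1) := (ρ.aut g⁻¹).hom.appLE O.1 O.1 hst s' - s'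
    refine ⟨ψ s', ?_⟩
    have e1 : (ρ.restrict O.1 O.2.1).act g ⊤ (ψ s') - ψ s' = ψ w := by
      rw [map_sub]
      exact congrArg (· - ψ s') (ρ.act_restrict_top_appLE O g s' hle hst)
    rw [e1]
    refine IsUnit.map _ ?_
    -- `w * t' = 1` in `Γ(X, O)`: compare germs at the generic point
    have hgs : X.presheaf.germ O.1 ξ hξO s' = a g := by
      rw [TopCat.Presheaf.germ_res_apply X.presheaf]; exact hs g
    have hgt : X.presheaf.germ O.1 ξ hξO t' =
        (functionFieldMap (ρ.aut g⁻¹).hom (a g) - a g)⁻¹ := by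
      rw [TopCat.Presheaf.germ_res_apply X.presheaf]; exact ht g
    have hgw : X.presheaf.germ O.1 ξ hξO w = functionFieldMap (ρ.aut g⁻¹).hom (a g) - a g := by
      rw [map_sub, hgs, germ_appLE_eq_functionFieldMap (ρ.aut g⁻¹).hom hst hξO hξO s', hgs]
    have hne : functionFieldMap (ρ.aut g⁻¹).hom (a g) - a g ≠ 0 := sub_ne_zero.mpr (ha g hg)
    have hwt : w * t' = 1 := by
      apply germ_injective_of_isIntegral X ξ hξO
      rw [map_mul, map_one, hgw, hgt, mul_inv_cancel₀ hne]
    exact IsUnit.of_mul_eq_one t' hwt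
  -- Step 5: `O → O/G` is étale, and so is `π` over the chart `O/G ⊆ X/G`
  have hO : Etale (ρ.pieceMk O) := ρ.etale_pieceMk_of_isUnit O hunit
  refine ⟨(ρ.gluedι O).opensRange, ⟨ρ.gluedMk hcov ξ, ?_⟩,
    ρ.morphismRestrict_gluedMk_of_pieceMk hcov @Etale O hO⟩
  exact ⟨ρ.pieceMk O ⟨ξ, hξO⟩, (ρ.gluedMk_apply hcov O ⟨ξ, hξO⟩).symm⟩

end Generic

end ActionOver

end Literature.AlgebraicGeometry.RelativeSpec

end
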